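import Literature.NumberTheory.Automorphic.ArtinLFunctionsRankOnePrimitive
import HarnessLib

/-!
# Coherent primitive ray class data for the powers of an Artin character of degree one

Topic `Literature/NumberTheory/Automorphic`; namespace `Literature.NumberTheory.Automorphic`.  Pure-proof
companion of `ArtinLFunctionsRankOnePrimitive` (Neukirch VII (10.6), Remark: `𝓛(L|K, χ, s) = L(χ̃, s)` with a
primitive `χ̃ mod 𝔣`).  For a character `ψ : Γ_K → GL_1(ℂ)` with `(det ψ)^n = 1` and every character `φ`
with `det φ = (det ψ)^j`, `gcd(j, n) = 1`, `j ≥ 1`, the primitive ray class datum of `φ` can be taken with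
**the same conductor `𝔣` and the same sign type `p`** as that of `ψ`: `(𝔣, χ_j, p)` with `χ_j` the primitive
associate of `χ̃^j` (`χ̃` the reciprocity datum of `ψ`), `L(s, φ) = L(χ_j, s)`, `L(s, φ^∨) = L(χ̄_j, s)`.
Contents: algebra of powers of ray class characters (`powChar`, values in `μ_n`, sign type / finite part /
definability of powers), and the main theorem `exists_coherent_rayClass_data`.

## References

* J. Neukirch, *Algebraic Number Theory*, Springer 1999, Ch. VII §10 (10.6) Remark; §6 p. 472. [NeukirchANT1999]
-/

noncomputable section

open scoped NumberField
open Field IsDedekindDomain NumberField Filter Complex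
open Literature.NumberTheory.GaloisRepresentations Literature.NumberTheory.LFunctions

universe u

namespace Literature.NumberTheory.Automorphic

variable {K : Type u} [Field K] [NumberField K]

/-! ### Powers and roots of unity -/

/-- `x^n = 1`, `x^j = 1`, `gcd(j, n) = 1` `⟹ x = 1`. [folklore] -/
theorem eq_one_of_pow_eq_one_of_coprime {M : Type*} [Monoid M] {x : M} {j n : ℕ} (hn : x ^ n = 1) (hj : x ^ j = 1)
    (hcop : Nat.Coprime j n) : x = 1 := by
  have h := (pow_gcd_eq_one (M := M)).mpr ⟨hj, hn⟩
  rwa [hcop, pow_one] at h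

/-- `x^n = 1`, `x ≠ 1`, `gcd(j,n) = 1` `⟹ x^j ≠ 1`. [folklore] -/
theorem pow_ne_one_of_coprime {M : Type*} [Monoid M] {x : M} {j n : ℕ} (hn : x ^ n = 1) (hx : x ≠ 1)
    (hcop : Nat.Coprime j n) : x ^ j ≠ 1 := fun h ↦ hx (eq_one_of_pow_eq_one_of_coprime hn h hcop)

/-- `x ↦ x^j` is injective on the `n`-th roots of unity for `gcd(j,n) = 1`. [folklore] -/
theorem pow_eq_one_iff_of_coprime {M : Type*} [Monoid M] {x : M} {j n : ℕ} (hn : x ^ n = 1) (hcop : Nat.Coprime j n) :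
    x ^ j = 1 ↔ x = 1 :=
  ⟨fun h ↦ eq_one_of_pow_eq_one_of_coprime hn h hcop, fun h ↦ by rw [h, one_pow]⟩

/-- `±1` with `x^n = 1`, `n` odd, is `1`. [folklore] -/
theorem sign_eq_one_of_pow_odd {x : ℂ} (hx : x = 1 ∨ x = -1) {n : ℕ} (hodd : Odd n) (hn : x ^ n = 1) : x = 1 := by
  rcases hx with h | h
  · exact h
  · rw [h, hodd.neg_one_pow] at hn; norm_num at hn

/-! ### Powers of ray class characters -/

section Powers

variable {𝔪 : Ideal (𝓞 K)} {χ : HeightOneSpectrum (𝓞 K) → ℂ}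

/-- The pointwise power `χ^j` of a function on primes. [folklore] -/
def powChar (χ : HeightOneSpectrum (𝓞 K) → ℂ) (j : ℕ) : HeightOneSpectrum (𝓞 K) → ℂ := fun v ↦ χ v ^ j

omit [NumberField K] in
/-- Unfolding `powChar`. [folklore] -/
@[simp] theorem powChar_apply (χ : HeightOneSpectrum (𝓞 K) → ℂ) (j : ℕ) (v : HeightOneSpectrum (𝓞 K)) :
    powChar χ j v = χ v ^ j := rfl

/-- `(χ^j)(𝔞) = χ(𝔞)^j`. [folklore] -/
theorem idealPow_powChar (χ : HeightOneSpectrum (𝓞 K) → ℂ) (j : ℕ) {I : Ideal (𝓞 K)} (hI : I ≠ ⊥) :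
    idealPow K (powChar χ j) I = idealPow K χ I ^ j := by
  unfold idealPow
  rw [finprod_pow (mulSupport_idealPow_finite χ hI)]
  exact finprod_congr fun v ↦ by rw [powChar_apply, ← pow_mul, mul_comm, pow_mul]

/-- **Values in `μ_n`**: if `χ(𝔭)^n = 1` at every prime `𝔭 ∤ 𝔪` then `χ(𝔞)^n = 1` for every nonzero `𝔞` prime
to `𝔪`. [folklore] -/
theorem idealPow_pow_eq_one (h𝔪 : 𝔪 ≠ ⊥) {n : ℕ} (hval : ∀ v : HeightOneSpectrum (𝓞 K), ¬ 𝔪 ≤ v.asIdeal → χ v ^ n = 1)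
    {I : Ideal (𝓞 K)} (hI : I ≠ ⊥) (hcop : IsCoprime I 𝔪) : idealPow K χ I ^ n = 1 := by
  rw [← idealPow_powChar χ n hI]
  unfold idealPow
  refine finprod_eq_one_of_forall_eq_one fun v ↦ ?_
  by_cases hc : (Associates.mk v.asIdeal).count (Associates.mk I).factors = 0
  · rw [hc, pow_zero]
  · have hdvd : v.asIdeal ∣ I := (Associates.count_ne_zero_iff_dvd hI v.irreducible).mp hc
    have hv : ¬ 𝔪 ≤ v.asIdeal := fun hle ↦ (isCoprime_iff_forall_not_le h𝔪).mp hcop v hle (Ideal.le_of_dvd hdvd)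
    rw [powChar_apply, hval v hv, one_pow]

/-- Powers of ray class characters are ray class characters. [folklore] -/
theorem _root_.Literature.NumberTheory.LFunctions.IsRayClassCharacter.powChar (hχ : IsRayClassCharacter 𝔪 χ) (j : ℕ) : IsRayClassCharacter 𝔪 (powChar χ j) := by
  refine ⟨fun v hv ↦ by rw [powChar_apply, norm_pow, hχ.norm_eq_one v hv, one_pow], fun b c hb hc hcc hbc hpos ↦ ?_⟩
  rw [idealPow_powChar χ j (by simpa using hb), idealPow_powChar χ j (by simpa using hc), hχ.idealPow_span_eq b c hb hc hcc hbc hpos]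

omit [NumberField K] in
/-- `star (χ^j) = (star χ)^j`. [folklore] -/
theorem star_powChar (χ : HeightOneSpectrum (𝓞 K) → ℂ) (j : ℕ) : star (powChar χ j) = powChar (star χ) j := by
  funext v; simp [powChar, star_pow]

end Powers

/-! ### Sign type, finite part and definability of powers -/

section PowersFine

variable {𝔪 : Ideal (𝓞 K)} {χ : HeightOneSpectrum (𝓞 K) → ℂ} {p : Finset {w : InfinitePlace K // w.IsReal}}

/-- The hypotheses tying `χ`, its sign type `p` and the exponent `n`: values in `μ_n` off `𝔪`, and either `n`
even or `p = ∅` (so that `sgn(·)^j = sgn(·)` for `j` prime to `n`). [folklore] -/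
structure PowerHyp (𝔪 : Ideal (𝓞 K)) (χ : HeightOneSpectrum (𝓞 K) → ℂ) (p : Finset {w : InfinitePlace K // w.IsReal})
    (n : ℕ) : Prop where
  /-- `χ(𝔭)^n = 1` for `𝔭 ∤ 𝔪` -/
  pow_eq_one : ∀ v : HeightOneSpectrum (𝓞 K), ¬ 𝔪 ≤ v.asIdeal → χ v ^ n = 1
  /-- `n` is even or the sign type is trivial -/
  even_or : Even n ∨ p = ∅

omit [NumberField K] in
/-- `sgn(a)^j = sgn(a)` in `ℂ` for `j` odd, or when the sign type is empty. [folklore] -/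
theorem sign_pow_eq_of_coprime {n j : ℕ} (h : Even n ∨ p = ∅) (hcop : Nat.Coprime j n) (hj : 1 ≤ j) (x : K) :
    (((SignType.sign (NumberField.realPow K p x)) : SignType) : ℂ) ^ j = ((SignType.sign (NumberField.realPow K p x)) : SignType) := by
  rcases h with hn | hp
  · -- `n` even forces `j` odd
    have hjodd : Odd j := by
      rcases Nat.even_or_odd j with hje | hjo
      · exfalso
        have h2 : 2 ∣ Nat.gcd j n := Nat.dvd_gcd (even_iff_two_dvd.mp hje) (even_iff_two_dvd.mp hn)
        rw [hcop] at h2; omega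
      · exact hjo
    have hj0 : j ≠ 0 := by omega
    rcases (SignType.sign (NumberField.realPow K p x)) with _ | _ | _ <;> simp [hjodd.neg_one_pow, hj0]
  · subst hp
    have : SignType.sign (NumberField.realPow K (∅ : Finset {w : InfinitePlace K // w.IsReal}) x) = 1 := by
      rw [sign_realPow_eq_prod]; simp
    rw [this]; simp

/-- `χ_f(a)^n = 1` (finite part values in `μ_n`) for `a` prime to `𝔪`, `a ≠ 0`. [folklore] -/
theorem finitePart_pow_eq_one (h𝔪 : 𝔪 ≠ ⊥) {n : ℕ} (H : PowerHyp 𝔪 χ p n) {a : 𝓞 K} (ha : a ≠ 0)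
    (hac : IsCoprime (Ideal.span {a}) 𝔪) : finitePart K 𝔪 χ p a ^ n = 1 := by
  rw [finitePart_of_isCoprime ha hac, mul_pow, idealPow_pow_eq_one h𝔪 H.pow_eq_one (by simpa using ha) hac, one_mul]
  rcases H.even_or with hn | hp
  · rcases sign_realPow_eq_one_or p (show (a : K) ≠ 0 by exact_mod_cast ha) with h | h <;> rw [h] <;> simp [hn.neg_one_pow]
  · subst hp
    rw [show SignType.sign (NumberField.realPow K (∅ : Finset {w : InfinitePlace K // w.IsReal}) (a : K)) = 1 by
      rw [sign_realPow_eq_prod]; simp]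
    simp

/-- `(χ^j)_f = (χ_f)^j`. [folklore] -/
theorem finitePart_powChar {n j : ℕ} (H : PowerHyp 𝔪 χ p n) (hcop : Nat.Coprime j n) (hj : 1 ≤ j) (a : 𝓞 K) :
    finitePart K 𝔪 (powChar χ j) p a = finitePart K 𝔪 χ p a ^ j := by
  classical
  by_cases h : a ≠ 0 ∧ IsCoprime (Ideal.span {a}) 𝔪
  · rw [finitePart_of_isCoprime h.1 h.2, finitePart_of_isCoprime h.1 h.2, idealPow_powChar χ j (by simpa using h.1), mul_pow,
      sign_pow_eq_of_coprime H.even_or hcop hj]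
  · rw [finitePart_of_not h, finitePart_of_not h, zero_pow (by omega)]

/-- **The sign type of a power**: `χ^j` has the same sign type `p`. [folklore] -/
theorem _root_.Literature.NumberTheory.LFunctions.IsSignType.powChar {n j : ℕ} (hp : IsSignType 𝔪 χ p) (H : PowerHyp 𝔪 χ p n) (hcop : Nat.Coprime j n) (hj : 1 ≤ j) :
    IsSignType 𝔪 (powChar χ j) p := by
  refine ⟨fun a ha ha1 ↦ ?_⟩
  rw [idealPow_powChar χ j (by simpa using ha), hp.idealPow_span_eq_sign a ha ha1, sign_pow_eq_of_coprime H.even_or hcop hj]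

/-- **Definability is the same for `χ` and `χ^j`** (`gcd(j,n) = 1`): `(𝒪/𝔣)^*`-factorisation of `χ_f` and of
`χ_f^j` are equivalent since `χ_f` takes values in `μ_n`. [folklore] -/
theorem isDefinableMod_powChar_iff (h𝔪 : 𝔪 ≠ ⊥) {n j : ℕ} (H : PowerHyp 𝔪 χ p n) (hcop : Nat.Coprime j n) (hj : 1 ≤ j)
    (𝔪' : Ideal (𝓞 K)) : IsDefinableMod 𝔪 (powChar χ j) p 𝔪' ↔ IsDefinableMod 𝔪 χ p 𝔪' := by
  constructor
  · intro h
    refine ⟨h.le, fun a ha hac ha1 ↦ ?_⟩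
    have := h.finitePart_eq_one a ha hac ha1
    rw [finitePart_powChar H hcop hj] at this
    exact eq_one_of_pow_eq_one_of_coprime (finitePart_pow_eq_one h𝔪 H ha hac) this hcop
  · intro h
    refine ⟨h.le, fun a ha hac ha1 ↦ ?_⟩
    rw [finitePart_powChar H hcop hj, h.finitePart_eq_one a ha hac ha1, one_pow]

/-- `PowerHyp` with the empty sign type from an odd `n`: `χ((a)) = sgn = ±1` and `∈ μ_n` force `+1`. [folklore] -/
theorem isSignType_empty_of_odd (hp : IsSignType 𝔪 χ p) (h𝔪 : 𝔪 ≠ ⊥) {n : ℕ} (hodd : Odd n)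
    (hval : ∀ v : HeightOneSpectrum (𝓞 K), ¬ 𝔪 ≤ v.asIdeal → χ v ^ n = 1) :
    IsSignType 𝔪 χ ∅ := by
  refine ⟨fun a ha ha1 ↦ ?_⟩
  have h1 := hp.idealPow_span_eq_sign a ha ha1
  have hpm : idealPow K χ (Ideal.span {a}) = 1 ∨ idealPow K χ (Ideal.span {a}) = -1 := by
    rcases sign_realPow_eq_one_or p (show (a : K) ≠ 0 by exact_mod_cast ha) with h | h <;> rw [h1, h] <;> simp
  have hn := idealPow_pow_eq_one h𝔪 hval (show Ideal.span {a} ≠ ⊥ by simpa using ha)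
    (isCoprime_span_singleton_of_sub_one_mem ha1)
  rw [sign_eq_one_of_pow_odd hpm hodd hn, show SignType.sign (NumberField.realPow K (∅ : Finset {w : InfinitePlace K // w.IsReal}) (a : K)) = 1 by
    rw [sign_realPow_eq_prod]; simp]
  simp

end PowersFine

/-! ### The coherent data -/

section Coherent

omit [NumberField K] in
/-- Ramification of `φ` with `det φ = (det ψ)^j`, `gcd(j, n) = 1`, `(det ψ)^n = 1`, is that of `ψ`. [folklore] -/
theorem isUnramifiedAt_iff_of_det_eq_pow (ψ φ : FramedArtinRep K 1) {n j : ℕ} (hpow : ∀ γ, FramedRep.det ψ γ ^ n = 1)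
    (hcop : Nat.Coprime j n) (hdet : ∀ γ, FramedRep.det φ γ = FramedRep.det ψ γ ^ j) (v : HeightOneSpectrum (𝓞 K)) :
    GaloisRep.IsUnramifiedAt v φ.toArtinRep ↔ GaloisRep.IsUnramifiedAt v ψ.toArtinRep := by
  rw [FramedGaloisRep.isUnramifiedAt_toGaloisRep_iff v φ, FramedGaloisRep.isUnramifiedAt_toGaloisRep_iff v ψ]
  refine forall₂_congr fun 𝔓 _ ↦ forall₂_congr fun τ _ ↦ ?_
  rw [← det_eq_one_iff_rankOne, ← det_eq_one_iff_rankOne, hdet, pow_eq_one_iff_of_coprime (hpow τ) hcop]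

/-- **Coherent primitive ray class data for the characters with `det φ = (det ψ)^j`, `gcd(j,n) = 1`** (same
conductor, same sign type; Neukirch VII (10.6) Remark with §6 p. 472).
[cite: NeukirchANT1999, Ch. VII §10 Thm. (10.6) (Remark); Ch. VII §6 p. 472] -/
theorem exists_coherent_rayClass_data (ψ : FramedArtinRep K 1) {n : ℕ}
    (hpow : ∀ γ : absoluteGaloisGroup K, FramedRep.det ψ γ ^ n = 1) :
    ∃ (𝔣 : Ideal (𝓞 K)) (χ : ℕ → HeightOneSpectrum (𝓞 K) → ℂ) (p : Finset {w : InfinitePlace K // w.IsReal}),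
      𝔣 ≠ ⊥ ∧ ∀ j : ℕ, 1 ≤ j → Nat.Coprime j n → ∀ φ : FramedArtinRep K 1,
        (∀ γ : absoluteGaloisGroup K, FramedRep.det φ γ = FramedRep.det ψ γ ^ j) →
          IsRayClassCharacter 𝔣 (χ j) ∧ IsPrimitive 𝔣 (χ j) ∧ IsSignType 𝔣 (χ j) p ∧
          (∀ s : ℂ, 1 < s.re → artinLFunction φ.toArtinRep s = rayClassLSeries 𝔣 (χ j) s) ∧
          (∀ s : ℂ, 1 < s.re →
            artinLFunction (FramedArtinRep.toArtinRep (FramedRep.dual φ)) s = rayClassLSeries 𝔣 (star (χ j)) s) := by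
  classical
  -- the reciprocity datum `(𝔪, χ̃)`
  obtain ⟨𝔪, h𝔪, χt, hχt, hunr, hram⟩ := artinReciprocity_rankOne_holds K ψ
  -- values in `μ_n`
  have hval : ∀ v : HeightOneSpectrum (𝓞 K), ¬ 𝔪 ≤ v.asIdeal → χt v ^ n = 1 := by
    intro v hv
    obtain ⟨𝔓, h𝔓⟩ := v.primesAbove_nonempty
    obtain ⟨σ, hσ⟩ := HeightOneSpectrum.exists_isArithFrobAt_of_mem_primesAbove_holds h𝔓
    rw [(hunr v hv).2 𝔓 h𝔓 σ hσ, ← Units.val_pow_eq_pow_val, hpow σ, Units.val_one]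
  -- the sign type `p*`
  obtain ⟨p₀, hp₀⟩ := hχt.exists_isSignType h𝔪
  set p : Finset {w : InfinitePlace K // w.IsReal} := if Even n then p₀ else ∅ with hpdef
  have hp : IsSignType 𝔪 χt p := by
    rw [hpdef]; split_ifs with he
    · exact hp₀
    · exact isSignType_empty_of_odd hp₀ h𝔪 (Nat.not_even_iff_odd.mp he) hval
  have H : PowerHyp 𝔪 χt p n := ⟨hval, by rw [hpdef]; split_ifs with he <;> simp [he]⟩
  -- conductor and transport data
  obtain ⟨𝔣, hD, hmax⟩ := exists_conductor hp h𝔪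
  obtain ⟨𝔟, h𝔟⟩ := exists_isTransportData h𝔪 hD.le
  have h𝔣0 : 𝔣 ≠ ⊥ := fun h ↦ h𝔪 (le_bot_iff.mp (h ▸ hD.le))
  -- the missing Euler factors (the same set for every `j`)
  set T : Finset (HeightOneSpectrum (𝓞 K)) := (Ideal.finite_factors h𝔪).toFinset.filter (fun v ↦ ¬ 𝔣 ≤ v.asIdeal) with hT
  have hmemT : ∀ v, v ∈ T ↔ 𝔪 ≤ v.asIdeal ∧ ¬ 𝔣 ≤ v.asIdeal := fun v ↦ by
    rw [hT, Finset.mem_filter, Set.Finite.mem_toFinset, Set.mem_setOf_eq, Ideal.dvd_iff_le]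
  -- `T = ∅`, by the argument of `ArtinLFunctionsRankOnePrimitive` for `ψ` itself
  have hTe : T = ∅ := by
    set χ₀ := transportChar K χt 𝔣 𝔟 with hχ₀
    have hχ₀ : IsRayClassCharacter 𝔣 χ₀ := isRayClassCharacter_transportChar hχt hp h𝔪 hD h𝔟
    have hL : ∀ s : ℂ, 1 < s.re → artinLFunction ψ.toArtinRep s = rayClassLSeries 𝔪 χt s := fun s hs ↦
      artinLFunction_eq_rayClassLSeries ψ h𝔪 hχt hunr hram hs
    set P : ℂ → ℂ := fun s ↦ ∏ v ∈ T, (1 - χ₀ v * ((Ideal.absNorm v.asIdeal : ℕ) : ℂ) ^ (-s)) with hPdef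
    have hE : ∀ s : ℂ, 1 < s.re → rayClassLSeries 𝔪 χt s = rayClassLSeries 𝔣 χ₀ s * P s := fun s hs ↦
      rayClassLSeries_eq_mul_prod_transportChar hχt hp h𝔪 hD h𝔟 hs
    by_contra hne
    obtain ⟨v₀, hv₀⟩ := Finset.nonempty_iff_ne_empty.mpr hne
    obtain ⟨hv₀m, hv₀f⟩ := (hmemT v₀).mp hv₀
    have hψnt : ∃ γ, FramedRep.det ψ γ ≠ 1 := by
      by_contra hall
      push Not at hall
      exact hram v₀ hv₀m ((FramedGaloisRep.isUnramifiedAt_toGaloisRep_iff v₀ ψ).mpr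
        fun 𝔓 _ σ _ ↦ (det_eq_one_iff_rankOne ψ σ).mp (hall σ))
    have hPd : Differentiable ℂ P := by
      have hq : ∀ v : HeightOneSpectrum (𝓞 K), ((Ideal.absNorm v.asIdeal : ℕ) : ℂ) ≠ 0 := fun v ↦
        Nat.cast_ne_zero.mpr (by have := HeightOneSpectrum.one_lt_absNorm v; omega)
      refine Differentiable.fun_finsetProd fun v _ ↦ ?_
      exact (differentiable_const _).fun_sub ((differentiable_const _).fun_mul
        (differentiable_id.fun_neg.const_cpow (Or.inl (hq v))))
    obtain ⟨G, -, hGd, hGs⟩ := rayClassLSeries_hasMeromorphicContinuation_holds (K := K) 𝔣 h𝔣0 χ₀ hχ₀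
    obtain ⟨Ψ, hΨ1, -, M, _, _, n', h1n, hζ⟩ := exists_dedekindZeta_eq_prod_artinLFunction_pow ψ hψnt
    have hF := fun j : ℕ ↦ exists_differentiableOn_eq_artinLFunction_rankOne (Ψ j)
    choose F hFd hFs using hF
    have hU : ({0, 1}ᶜ : Set ℂ) ⊆ ({1}ᶜ : Set ℂ) := Set.compl_subset_compl.mpr (Set.subset_insert _ _)
    have hζd : DifferentiableOn ℂ (dedekindZetaCont M) ({0, 1}ᶜ : Set ℂ) :=
      (NumberField.isDedekindZetaContinuation_dedekindZetaCont_holds M).differentiableOn.mono hU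
    have hprod : Set.EqOn (dedekindZetaCont M) (fun s ↦ ∏ j ∈ Finset.range n', F j s) ({0, 1}ᶜ : Set ℂ) := by
      refine eqOn_compl_zero_one_of_eqOn_one_lt_re hζd (DifferentiableOn.fun_finsetProd fun j _ ↦ hFd j) fun s hs ↦ ?_
      rw [(NumberField.isDedekindZetaContinuation_dedekindZetaCont_holds M).eqOn hs, hζ s hs]
      exact Finset.prod_congr rfl fun j _ ↦ (hFs j s hs).symm
    have hone : Set.EqOn (F 1) (G * P) ({0, 1}ᶜ : Set ℂ) := by
      refine eqOn_compl_zero_one_of_eqOn_one_lt_re (hFd 1) (hGd.mul hPd.differentiableOn) fun s hs ↦ ?_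
      rw [hFs 1 s hs, hΨ1, hL s hs, hE s hs, Pi.mul_apply, hGs s hs]
    obtain ⟨s₀, hre, him, hv₀0⟩ := exists_one_sub_mul_cpow_neg_eq_zero (hχ₀.norm_eq_one v₀ hv₀f)
      (HeightOneSpectrum.one_lt_absNorm v₀)
    have hs₀U : s₀ ∈ ({0, 1}ᶜ : Set ℂ) := by
      simp only [Set.mem_compl_iff, Set.mem_insert_iff, Set.mem_singleton_iff, not_or]
      exact ⟨fun h ↦ him (by rw [h]; simp), fun h ↦ him (by rw [h]; simp)⟩
    have hP0 : P s₀ = 0 := Finset.prod_eq_zero hv₀ hv₀0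
    have hζ0 : dedekindZetaCont M s₀ = 0 := by
      rw [hprod hs₀U]
      show ∏ j ∈ Finset.range n', F j s₀ = 0
      refine Finset.prod_eq_zero (Finset.mem_range.mpr h1n) ?_
      rw [hone hs₀U, Pi.mul_apply, hP0, mul_zero]
    exact dedekindZetaCont_ne_zero_of_re_eq_zero M hre him hζ0
  -- the data
  refine ⟨𝔣, fun j ↦ transportChar K (powChar χt j) 𝔣 𝔟, p, h𝔣0, fun j hj hcop φ hdet ↦ ?_⟩
  set χtj := powChar χt j with hχtj
  have hχtj' : IsRayClassCharacter 𝔪 χtj := hχt.powChar j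
  have hpj : IsSignType 𝔪 χtj p := hp.powChar H hcop hj
  have hDj : IsDefinableMod 𝔪 χtj p 𝔣 := (isDefinableMod_powChar_iff h𝔪 H hcop hj 𝔣).mpr hD
  have hmaxj : ∀ 𝔪' : Ideal (𝓞 K), IsDefinableMod 𝔪 χtj p 𝔪' → 𝔪' ≤ 𝔣 := fun 𝔪' h ↦
    hmax 𝔪' ((isDefinableMod_powChar_iff h𝔪 H hcop hj 𝔪').mp h)
  -- ramification and values of `φ`
  have hunrφ : ∀ v : HeightOneSpectrum (𝓞 K), ¬ 𝔪 ≤ v.asIdeal →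
      GaloisRep.IsUnramifiedAt v φ.toArtinRep ∧
        ∀ 𝔓 ∈ v.primesAbove, ∀ σ : absoluteGaloisGroup K, IsArithFrobAt (𝓞 K) σ 𝔓 → χtj v = (FramedRep.det φ σ : ℂ) := by
    intro v hv
    obtain ⟨hur, hvalv⟩ := hunr v hv
    refine ⟨(isUnramifiedAt_iff_of_det_eq_pow ψ φ hpow hcop hdet v).mpr hur, fun 𝔓 h𝔓 σ hσ ↦ ?_⟩
    rw [hχtj, powChar_apply, hvalv 𝔓 h𝔓 σ hσ, hdet, Units.val_pow_eq_pow_val]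
  have hramφ : ∀ v : HeightOneSpectrum (𝓞 K), 𝔪 ≤ v.asIdeal → ¬ GaloisRep.IsUnramifiedAt v φ.toArtinRep := fun v hv h ↦
    hram v hv ((isUnramifiedAt_iff_of_det_eq_pow ψ φ hpow hcop hdet v).mp h)
  have hLφ : ∀ s : ℂ, 1 < s.re → artinLFunction φ.toArtinRep s = rayClassLSeries 𝔪 χtj s := fun s hs ↦
    artinLFunction_eq_rayClassLSeries φ h𝔪 hχtj' hunrφ hramφ hs
  -- the dual
  have hunrφ' : ∀ v : HeightOneSpectrum (𝓞 K), ¬ 𝔪 ≤ v.asIdeal →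
      GaloisRep.IsUnramifiedAt v (FramedArtinRep.toArtinRep (FramedRep.dual φ)) ∧
        ∀ 𝔓 ∈ v.primesAbove, ∀ σ : absoluteGaloisGroup K, IsArithFrobAt (𝓞 K) σ 𝔓 →
          (star χtj) v = (FramedRep.det (FramedRep.dual φ) σ : ℂ) := by
    intro v hv
    obtain ⟨hur, hvalv⟩ := hunrφ v hv
    refine ⟨(FramedGaloisRep.isUnramifiedAt_toGaloisRep_iff v _).mpr
      ((FramedGaloisRep.isUnramifiedAt_dual_iff v φ).mpr ((FramedGaloisRep.isUnramifiedAt_toGaloisRep_iff v φ).mp hur)),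
      fun 𝔓 h𝔓 σ hσ ↦ ?_⟩
    have h1 : ‖χtj v‖ = 1 := hχtj'.norm_eq_one v hv
    rw [Pi.star_apply, det_dual_apply, Units.val_inv_eq_inv_val, ← hvalv 𝔓 h𝔓 σ hσ, Complex.inv_eq_conj h1]
    rfl
  have hramφ' : ∀ v : HeightOneSpectrum (𝓞 K), 𝔪 ≤ v.asIdeal →
      ¬ GaloisRep.IsUnramifiedAt v (FramedArtinRep.toArtinRep (FramedRep.dual φ)) := fun v hv h ↦
    hramφ v hv ((FramedGaloisRep.isUnramifiedAt_toGaloisRep_iff v φ).mpr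
      ((FramedGaloisRep.isUnramifiedAt_dual_iff v φ).mp ((FramedGaloisRep.isUnramifiedAt_toGaloisRep_iff v _).mp h)))
  have hLφ' : ∀ s : ℂ, 1 < s.re →
      artinLFunction (FramedArtinRep.toArtinRep (FramedRep.dual φ)) s = rayClassLSeries 𝔪 (star χtj) s := fun s hs ↦
    artinLFunction_eq_rayClassLSeries (FramedRep.dual φ) h𝔪 hχtj'.star hunrφ' hramφ' hs
  -- Euler relations with `T = ∅`
  have hE : ∀ s : ℂ, 1 < s.re → rayClassLSeries 𝔪 χtj s = rayClassLSeries 𝔣 (transportChar K χtj 𝔣 𝔟) s := by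
    intro s hs
    have := rayClassLSeries_eq_mul_prod_transportChar hχtj' hpj h𝔪 hDj h𝔟 hs
    rw [this, show (Ideal.finite_factors h𝔪).toFinset.filter (fun v ↦ ¬ 𝔣 ≤ v.asIdeal) = T from rfl, hTe,
      Finset.prod_empty, mul_one]
  have hE' : ∀ s : ℂ, 1 < s.re → rayClassLSeries 𝔪 (star χtj) s = rayClassLSeries 𝔣 (star (transportChar K χtj 𝔣 𝔟)) s := by
    intro s hs
    have := rayClassLSeries_eq_mul_prod_transportChar hχtj'.star hpj.star h𝔪 hDj.star h𝔟 hs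
    rw [transportChar_star] at this
    rw [this, show (Ideal.finite_factors h𝔪).toFinset.filter (fun v ↦ ¬ 𝔣 ≤ v.asIdeal) = T from rfl, hTe,
      Finset.prod_empty, mul_one]
  exact ⟨isRayClassCharacter_transportChar hχtj' hpj h𝔪 hDj h𝔟, isPrimitive_transportChar hχtj' hpj h𝔪 hDj hmaxj h𝔟,
    isSignType_transportChar hχtj' hpj h𝔪 hDj h𝔟, fun s hs ↦ by rw [hLφ s hs, hE s hs],
    fun s hs ↦ by rw [hLφ' s hs, hE' s hs]⟩

end Coherent

end Literature.NumberTheory.Automorphic
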